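import Mathlib

/-!
# Ladders are closed under lexicographic products (support file)

Item `stmt-MatrixMultiplication-14308` (`FourierTwoFamiliesModP.PrimeTwoFamilies`, CKSU 2005
Conj. 4.7 with prime cyclic hosts), line Sketch, stub `isLadder_lexProd`.

Line Sketch reduces the conjecture to the cyclic LADDER conjecture about ordered families
`(X c, Y c)_{c < r}` of finite subsets of an abelian group with

* (directness, `hW`) each class is direct: `(x - x') + (y - y') = 0` forces `x = x'` and
  `y = y'` for `x, x' ∈ X c`, `y, y' ∈ Y c`;
* (one-directional separation, `hL`) for `p < q` the lower cross differences `y' - x'`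
  (`x' ∈ X p`, `y' ∈ Y q`) avoid every diagonal difference `y - x` (`x ∈ X c`, `y ∈ Y c`).

This file shows that ladders are closed under LEXICOGRAPHIC products: given a ladder
`(X₁ c, Y₁ c)_{c < r₁}` in `G₁` and a ladder `(X₂ c, Y₂ c)_{c < r₂}` in `G₂`, the family indexed by
`Fin (r₁ * r₂)` with classes `X c = X₁ c.divNat ×ˢ X₂ c.modNat ⊆ G₁ × G₂` (and likewise `Y`) is
again a ladder.  Since `c = c.divNat * r₂ + c.modNat`, the order on `Fin (r₁ * r₂)` is exactly
the lexicographic order on the pairs `(c.divNat, c.modNat)`, which is what makes the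
one-directional separation survive: for `p < q` either `p.divNat < q.divNat` (separate in the
first coordinate) or `p.divNat = q.divNat` and `p.modNat < q.modNat` (separate in the second).
Consequently the number of classes, the co-volume and the host size all multiply, so the merit of
a finite alphabet of ladders is super-multiplicative.
-/

-- single-conjunct summit: the mandated namespace repeats `MatrixMultiplication` (summit = sub-problem).
set_option linter.dupNamespace false

namespace Summit.MatrixMultiplication.MatrixMultiplication.Theorems.PrimeTwoFamilies.LadderLift

/-- The order on `Fin (r₁ * r₂)` refines the lexicographic order on `(divNat, modNat)`:
if `p < q` then either the quotients already compare strictly, or the remainders do. -/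
private theorem divNat_lt_or_modNat_lt {r₁ r₂ : ℕ} {p q : Fin (r₁ * r₂)} (hpq : p < q) :
    p.divNat < q.divNat ∨ p.modNat < q.modNat := by
  rcases lt_or_ge p.divNat q.divNat with hlt | hle
  · exact Or.inl hlt
  · right
    rw [Fin.le_def, Fin.coe_divNat, Fin.coe_divNat] at hle
    rw [Fin.lt_def, Fin.coe_modNat, Fin.coe_modNat]
    have hp := Nat.div_add_mod (p : ℕ) r₂
    have hq := Nat.div_add_mod (q : ℕ) r₂
    have hmul := Nat.mul_le_mul_left r₂ hle
    have hpq' : (p : ℕ) < q := hpq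
    omega

/-- **Lexicographic products of ladders are ladders.**  If `(X₁ c, Y₁ c)_{c < r₁}` is a ladder in
`G₁` (each class direct, `hW₁`, and one-directionally separated, `hL₁`) and `(X₂ c, Y₂ c)_{c < r₂}`
is a ladder in `G₂` (`hW₂`, `hL₂`), then the family indexed by `c : Fin (r₁ * r₂)` with classes
`X₁ c.divNat ×ˢ X₂ c.modNat` and `Y₁ c.divNat ×ˢ Y₂ c.modNat` in `G₁ × G₂` is a ladder: each class
is direct (first conjunct) and the family is one-directionally separated (second conjunct). -/
theorem isLadder_lexProd {G₁ G₂ : Type*} [AddCommGroup G₁] [AddCommGroup G₂] {r₁ r₂ : ℕ}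
    (X₁ Y₁ : Fin r₁ → Finset G₁) (X₂ Y₂ : Fin r₂ → Finset G₂)
    (hW₁ : ∀ c : Fin r₁, ∀ x ∈ X₁ c, ∀ x' ∈ X₁ c, ∀ y ∈ Y₁ c, ∀ y' ∈ Y₁ c,
      (x - x') + (y - y') = 0 → x = x' ∧ y = y')
    (hL₁ : ∀ c p q : Fin r₁, p < q → ∀ x ∈ X₁ c, ∀ y ∈ Y₁ c, ∀ x' ∈ X₁ p, ∀ y' ∈ Y₁ q,
      y - x ≠ y' - x')
    (hW₂ : ∀ c : Fin r₂, ∀ x ∈ X₂ c, ∀ x' ∈ X₂ c, ∀ y ∈ Y₂ c, ∀ y' ∈ Y₂ c,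
      (x - x') + (y - y') = 0 → x = x' ∧ y = y')
    (hL₂ : ∀ c p q : Fin r₂, p < q → ∀ x ∈ X₂ c, ∀ y ∈ Y₂ c, ∀ x' ∈ X₂ p, ∀ y' ∈ Y₂ q,
      y - x ≠ y' - x') :
    (∀ c : Fin (r₁ * r₂), ∀ x ∈ X₁ c.divNat ×ˢ X₂ c.modNat, ∀ x' ∈ X₁ c.divNat ×ˢ X₂ c.modNat,
        ∀ y ∈ Y₁ c.divNat ×ˢ Y₂ c.modNat, ∀ y' ∈ Y₁ c.divNat ×ˢ Y₂ c.modNat,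
        (x - x') + (y - y') = 0 → x = x' ∧ y = y') ∧
    (∀ c p q : Fin (r₁ * r₂), p < q →
        ∀ x ∈ X₁ c.divNat ×ˢ X₂ c.modNat, ∀ y ∈ Y₁ c.divNat ×ˢ Y₂ c.modNat,
        ∀ x' ∈ X₁ p.divNat ×ˢ X₂ p.modNat, ∀ y' ∈ Y₁ q.divNat ×ˢ Y₂ q.modNat, y - x ≠ y' - x') := by
  refine ⟨fun c x hx x' hx' y hy y' hy' h => ?_, fun c p q hpq x hx y hy x' hx' y' hy' h => ?_⟩
  · -- directness: split the equation in `G₁ × G₂` into its two components.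
    rw [Finset.mem_product] at hx hx' hy hy'
    have h1 : (x.1 - x'.1) + (y.1 - y'.1) = 0 := by
      simpa only [Prod.fst_add, Prod.fst_sub, Prod.fst_zero] using congrArg Prod.fst h
    have h2 : (x.2 - x'.2) + (y.2 - y'.2) = 0 := by
      simpa only [Prod.snd_add, Prod.snd_sub, Prod.snd_zero] using congrArg Prod.snd h
    obtain ⟨hx1, hy1⟩ := hW₁ c.divNat x.1 hx.1 x'.1 hx'.1 y.1 hy.1 y'.1 hy'.1 h1
    obtain ⟨hx2, hy2⟩ := hW₂ c.modNat x.2 hx.2 x'.2 hx'.2 y.2 hy.2 y'.2 hy'.2 h2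
    exact ⟨Prod.ext hx1 hx2, Prod.ext hy1 hy2⟩
  · -- separation: `p < q` forces `p.divNat < q.divNat` or `p.modNat < q.modNat`.
    rw [Finset.mem_product] at hx hy hx' hy'
    rcases divNat_lt_or_modNat_lt hpq with hlt | hlt
    · have h1 : y.1 - x.1 = y'.1 - x'.1 := by
        simpa only [Prod.fst_sub] using congrArg Prod.fst h
      exact hL₁ c.divNat p.divNat q.divNat hlt x.1 hx.1 y.1 hy.1 x'.1 hx'.1 y'.1 hy'.1 h1
    · have h2 : y.2 - x.2 = y'.2 - x'.2 := by
        simpa only [Prod.snd_sub] using congrArg Prod.snd h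
      exact hL₂ c.modNat p.modNat q.modNat hlt x.2 hx.2 y.2 hy.2 x'.2 hx'.2 y'.2 hy'.2 h2

end Summit.MatrixMultiplication.MatrixMultiplication.Theorems.PrimeTwoFamilies.LadderLift
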